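import Mathlib
import Summits.CriticalPhenomena.CardyFormulaZ2.Theses.CardyFlipRusso
import Summits.CriticalPhenomena.CardyFormulaZ2.Theorems.CardyFlipRussoSquareFromVoronoiHubDefs
import Summits.CriticalPhenomena.CardyFormulaZ2.Theorems.CardyFlipRussoSquareFromVoronoiHubSmallCellsPart3
import Summits.CriticalPhenomena.CardyFormulaZ2.Theorems.CardyFlipRussoSquareFromVoronoiHubSmallCellsPart4
import Literature.Probability.Percolation.VoronoiCrossing
import Literature.Probability.Percolation.SitePercolationMeasure
import Literature.Analysis.FunctionSpaces.PoissonPointProcess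
import Literature.Analysis.FunctionSpaces.PoissonMecke
import Literature.Analysis.FunctionSpaces.PoissonPointProcessUniqueness

/-!
# Stub `stub_smallCells` (K0) — line `Sketch`, crux `SquareFromVoronoiHub` (stmt-CriticalPhenomena-6434)

**K0 — cells of scale `δ²` ARE site percolation.** For Poisson nuclei `PB`, `PW` of Lebesgue
intensity on `ℂ` and every conformal rectangle `R`, the crude `G_s(δ)` crossing probability of the
Voronoi-block colouring at cell scale `s = δ²` (`blockCrossingProb PB PW R δ (δ²)`, objects of
`Theorems/CardyFlipRussoSquareFromVoronoiHubDefs.lean`) and that of i.i.d. fair site percolation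
on `G_s` (`siteCrossingProb R δ`) differ by `o(1)` as `δ → 0⁺` (`stub_smallCells`, stated verbatim
as registered in the skeleton `Cruxes/SquareFromVoronoiHub/Lines/Sketch.lean`).

Proof (Bollobás–Riordan 2006, Ch. 8 §8.3 flavour, fully elementary).  `PB = PW =: P` by Rényi
uniqueness.  Fix `δ ∈ (0, 1]`.  The window `W_δ = {y | δ z(y) ∈ Ω}` is finite, `|W_δ| ≤ 98 ρ²/δ²`
(`Ω ⊆ B(0, ρ)`), and the crude crossing event is determined by the sites of `W_δ` (Part 4,
`crudeCrossing_determinedBy`).  Around the microscopic position `δ z(y)/δ²` of each window site put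
`N` annuli of total radius `1/(4δ)`; distinct sites of `G_s` are `≥ 1/2` apart (Part 4,
`half_le_dist_zGs`), so all these cells are pairwise disjoint and (Part 2) the count vectors of
different sites are
independent under `P ⊗ P`.  For a colour pattern `y` on `W_δ` let `G y` be the event that every
site's count vector is black-forcing (resp. white-forcing) according to `y`, and both
configurations are non-empty (a co-null condition); on `G y` the block colouring agrees with `y`
(Part 3, colour forcing), and `P ⊗ P (G y) = ∏ (fair-site probabilities) ≥ (q/2)^{|W_δ|}` with
`q = 1 - 2 e^{-2V}`, `V = π/(16 δ²)`, once `N ≥ 2 V² e^{2V}` (Part 3, fairness bound).  The TV lemma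
of Part 1 gives `|block - site| ≤ 1 - q^{|W_δ|} ≤ 2 |W_δ| e^{-2V} ≤ 196 ρ² δ⁻² e^{-π/(8δ²)} → 0`.
-/

noncomputable section

open scoped Topology MeasureTheory ENNReal Pointwise
open Filter Set MeasureTheory ProbabilityTheory

namespace Summit.CriticalPhenomena.CardyFormulaZ2.Cruxes.SquareFromVoronoiHub.VoronoiBlocks.SmallCells

open Literature.Analysis.FunctionSpaces (PointConfig IsPoissonPointProcess)
open Literature.Probability.RandomPlanarGeometry (ConformalRectangle cardyFunction)
open Literature.Probability.Percolation (SiteConfig sitePercolation siteConnIn half blackRegion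
  voronoiCrossing DeterminedBy determinedBy_iff siteOpenGraph_adj)

/-! ### The estimate at a fixed mesh -/

/-- **K0 at a fixed mesh.** For `P` Poisson of Lebesgue intensity, `Ω ⊆ B(0, ρ)` with `ρ ≥ 1` and
`0 < δ ≤ 1`:  `|blockCrossingProb P P R δ δ² - siteCrossingProb R δ| ≤ 196 ρ² δ⁻² e^{-π/(8δ²)}`.
(Bollobás–Riordan 2006, Ch. 8 §8.3 flavour: TV comparison of the block colouring of the finite
window with fair site percolation via disjoint annuli, independence of Poisson counts, and the
black/white symmetry.) [folklore] -/
theorem abs_blockCrossingProb_sub_siteCrossingProb_le {P : Measure (PointConfig ℂ)}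
    (hP : IsPoissonPointProcess (volume : Measure ℂ) P) (R : ConformalRectangle) {ρ : ℝ}
    (hρ : 1 ≤ ρ) (hΩ : R.carrier ⊆ Metric.ball 0 ρ) {δ : ℝ} (hδ : 0 < δ) (hδ1 : δ ≤ 1) :
    |blockCrossingProb P P R δ (δ ^ 2) - siteCrossingProb R δ| ≤
      196 * ρ ^ 2 * (δ⁻¹ ^ 2 * Real.exp (-(Real.pi / 8 * δ⁻¹ ^ 2))) := by
  classical
  haveI := hP.isProbabilityMeasure
  have hρ0 : 0 < ρ := by linarith
  have hρδ : 1 ≤ ρ / δ := (one_le_div hδ).2 (hδ1.trans hρ)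
  -- the window
  set K : ℕ := ⌈ρ / δ⌉₊ + 1 with hK
  have hK1 : ρ / δ + 1 / 2 < K := by
    rw [hK]; push_cast
    linarith [Nat.le_ceil (ρ / δ)]
  have hK2 : (K : ℝ) ≤ ρ / δ + 2 := by
    rw [hK]; push_cast
    linarith [Nat.ceil_lt_add_one (by positivity : (0 : ℝ) ≤ ρ / δ)]
  set box : Finset (ℤ × ℤ) := Finset.Icc (-(K : ℤ)) K ×ˢ Finset.Icc (-(K : ℤ)) K with hbox
  have hWsub := window_subset hδ K hK1 hΩ
  have hWfin : {y : (ℤ × ℤ) ⊕ (ℤ × ℤ) | (δ : ℂ) * zGs y ∈ R.carrier}.Finite :=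
    (Finset.finite_toSet _).subset hWsub
  set F := hWfin.toFinset with hFdef
  have hF : (↑F : Set ((ℤ × ℤ) ⊕ (ℤ × ℤ))) = {y | (δ : ℂ) * zGs y ∈ R.carrier} :=
    hWfin.coe_toFinset
  set n := F.card with hn
  have hnle : (n : ℝ) ≤ 98 * ρ ^ 2 * δ⁻¹ ^ 2 := by
    have h1 : n ≤ (box.disjSum box).card := by
      refine Finset.card_le_card (Finset.coe_subset.1 ?_)
      rw [hF]; exact hWsub
    have h2 : (n : ℝ) ≤ 2 * (2 * K + 1) ^ 2 := by
      rw [← card_box_disjSum K]; exact_mod_cast h1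
    have h3 : (2 * (K : ℝ) + 1) ≤ 7 * (ρ / δ) := by linarith
    have h4 : (2 * (K : ℝ) + 1) ^ 2 ≤ (7 * (ρ / δ)) ^ 2 :=
      pow_le_pow_left₀ (by positivity) h3 2
    calc (n : ℝ) ≤ 2 * (2 * K + 1) ^ 2 := h2
      _ ≤ 2 * (7 * (ρ / δ)) ^ 2 := by linarith
      _ = 98 * ρ ^ 2 * δ⁻¹ ^ 2 := by rw [div_eq_mul_inv]; ring
  -- the scales
  have hs0 : (0 : ℝ) < δ ^ 2 := by positivity
  set Vv : ℝ := Real.pi / 16 * δ⁻¹ ^ 2 with hVv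
  have hVv0 : 0 < Vv := by positivity
  set N : ℕ := ⌈2 * Vv ^ 2 * Real.exp (2 * Vv)⌉₊ + 1 with hN
  have hN0 : 0 < N := Nat.succ_pos _
  have hN0' : (0 : ℝ) < N := by exact_mod_cast hN0
  set w : ℝ := δ⁻¹ / 4 / N with hw
  have hw0 : 0 < w := by positivity
  have hNw : (N : ℝ) * w = δ⁻¹ / 4 := by rw [hw]; field_simp
  have hV : Real.pi * ((N : ℝ) * w) ^ 2 = Vv := by rw [hNw, hVv]; ring
  -- sites, positions, cells
  set p : ↥F → ℂ := fun i => (δ : ℂ) * zGs (i : (ℤ × ℤ) ⊕ (ℤ × ℤ)) with hp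
  set x : ↥F → ℂ := fun i => p i / ((δ ^ 2 : ℝ) : ℂ) with hx
  have hxp : ∀ i, x i = p i / ((δ ^ 2 : ℝ) : ℂ) := fun i => rfl
  -- all the cells are pairwise disjoint
  have hd : Pairwise (Function.onFun Disjoint fun j : ↥F × Fin N => cells x w N j.1 j.2) := by
    intro j j' hjj'
    by_cases hi : j.1 = j'.1
    · have hk : (j.2 : ℕ) ≠ j'.2 := fun h => hjj' (Prod.ext hi (Fin.ext h))
      change Disjoint (shell (x j.1) w j.2) (shell (x j'.1) w j'.2)
      rw [hi]
      exact disjoint_shell _ hw0 hk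
    · have hne : (j.1 : (ℤ × ℤ) ⊕ (ℤ × ℤ)) ≠ j'.1 := fun h => hi (Subtype.ext h)
      have h1 := half_le_dist_zGs hne
      have h2 : dist (x j.1) (x j'.1) =
          dist (zGs (j.1 : (ℤ × ℤ) ⊕ (ℤ × ℤ))) (zGs (j'.1 : (ℤ × ℤ) ⊕ (ℤ × ℤ))) / δ :=
        dist_div_scale hδ _ _
      have hdist : 2 * ((N : ℝ) * w) ≤ dist (x j.1) (x j'.1) := by
        rw [h2, hNw, le_div_iff₀ hδ]
        have : 2 * (δ⁻¹ / 4) * δ = 1 / 2 := by field_simp; ring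
        rw [this]; exact h1
      exact disjoint_shell_of_le_dist hw0.le j.2.2 j'.2.2 hdist
  have hA : ∀ (i : ↥F) (k : Fin N), MeasurableSet (cells x w N i k) := measurableSet_cells x w N
  have hfin : ∀ (i : ↥F) (k : Fin N), volume (cells x w N i k) ≠ ∞ := fun i k =>
    volume_shell_ne_top _ _ _
  -- the events `G y`
  set B : (↥F → Prop) → ↥F → Set (Fin N ⊕ Fin N → ℕ∞) :=
    fun y i => {v | (y i → v ∈ Bblack N) ∧ (¬ y i → v ∈ Bwhite N)} with hB
  set NE : Set (PointConfig ℂ × PointConfig ℂ) :=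
    {c | c.1.count Set.univ ≠ 0 ∧ c.2.count Set.univ ≠ 0} with hNE
  have hNEm : MeasurableSet NE := by
    have h0 : MeasurableSet {m : ℕ∞ | m ≠ 0} := (Set.to_countable _).measurableSet
    exact (((PointConfig.measurable_count MeasurableSet.univ).comp measurable_fst) h0).inter
      (((PointConfig.measurable_count MeasurableSet.univ).comp measurable_snd) h0)
  set G : (↥F → Prop) → Set (PointConfig ℂ × PointConfig ℂ) :=
    fun y => (⋂ i, siteCounts (cells x w N) i ⁻¹' B y i) ∩ NE with hG
  -- the fairness parameter
  set q' : ℝ := 1 - 2 * Real.exp (-2 * Vv) with hq'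
  set q : ℝ := max 0 q' with hq
  have hq0 : 0 ≤ q := le_max_left _ _
  have hq1 : q ≤ 1 := max_le zero_le_one (by have := Real.exp_pos (-2 * Vv); linarith)
  have hNge : 2 * Vv ^ 2 * Real.exp (2 * Vv) ≤ N := by
    rw [hN]; push_cast
    exact (Nat.le_ceil _).trans (le_add_of_nonneg_right zero_le_one)
  have htie : 2 * Vv ^ 2 / N ≤ Real.exp (-2 * Vv) := by
    rw [div_le_iff₀ hN0']
    have e : 2 * Vv ^ 2 = (2 * Vv ^ 2 * Real.exp (2 * Vv)) * Real.exp (-2 * Vv) := by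
      rw [mul_assoc, ← Real.exp_add]; ring_nf; simp
    rw [e, mul_comm (Real.exp (-2 * Vv)) (N : ℝ)]
    exact mul_le_mul_of_nonneg_right hNge (Real.exp_nonneg _)
  -- measurability of `G y`
  have hGm : ∀ y, MeasurableSet (G y) := fun y =>
    (MeasurableSet.iInter fun i => measurableSet_siteCounts_preimage hA i _).inter hNEm
  -- on `G y` the block colouring agrees with `y`
  have hGX : ∀ y, ∀ c ∈ G y, ∀ i : ↥F, ((i : (ℤ × ℤ) ⊕ (ℤ × ℤ)) ∈ blockConfig δ (δ ^ 2) c ↔ y i) := by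
    intro y c hc i
    have hci : siteCounts (cells x w N) i c ∈ B y i := Set.mem_iInter.1 hc.1 i
    have hne1 : (c.1 : Set ℂ).Nonempty := by
      obtain ⟨z, hz, -⟩ := (count_ne_zero_iff c.1 _).1 hc.2.1
      exact ⟨z, hz⟩
    have hne2 : (c.2 : Set ℂ).Nonempty := by
      obtain ⟨z, hz, -⟩ := (count_ne_zero_iff c.2 _).1 hc.2.2
      exact ⟨z, hz⟩
    rw [mem_blockConfig_iff]
    by_cases hy : y i
    · simp only [hy, iff_true]
      exact infDist_le_of_mem_Bblack hs0 hw0 p hxp i c hne2 (hci.1 hy)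
    · simp only [hy, iff_false, not_le]
      exact infDist_lt_of_mem_Bwhite hs0 hw0 p hxp i c hne1 (hci.2 hy)
  -- `P ⊗ P (G y) ≥ (q/2)^n`
  have hGge : ∀ y, (q / 2) ^ n ≤ (P.prod P).real (G y) := by
    intro y
    have hconull : (P.prod P).real (G y) =
        (P.prod P).real (⋂ i, siteCounts (cells x w N) i ⁻¹' B y i) := by
      simp only [hG, measureReal_def, hNE, prod_measure_inter_nonempty hP hP]
    rw [hconull, prod_measureReal_iInter_siteCounts hP hP hA hd hfin (B y)]
    have hfac : ∀ i, q / 2 ≤ (P.prod P).real (siteCounts (cells x w N) i ⁻¹' B y i) := by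
      intro i
      have key : (1 - Real.exp (-2 * (Real.pi * ((N : ℝ) * w) ^ 2)) -
          2 * (Real.pi * ((N : ℝ) * w) ^ 2) ^ 2 / N) / 2 ≤
          (P.prod P).real (siteCounts (cells x w N) i ⁻¹' B y i) := by
        by_cases hy : y i
        · have hBi : B y i = Bblack N := by
            ext v; simp [hB, hy]
          rw [hBi]
          exact half_le_measureReal_Bblack hP hw0 i
        · have hBi : B y i = Bwhite N := by
            ext v; simp [hB, hy]
          rw [hBi]
          exact half_le_measureReal_Bwhite hP hw0 i
      rw [hV] at key
      have hq'le : q' / 2 ≤ (P.prod P).real (siteCounts (cells x w N) i ⁻¹' B y i) := by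
        rw [hq']; linarith
      rcases le_total 0 q' with h0 | h0
      · rw [hq, max_eq_right h0]; exact hq'le
      · rw [hq, max_eq_left h0, zero_div]; exact measureReal_nonneg
    calc (q / 2) ^ n = ∏ _i : ↥F, q / 2 := by
          rw [Finset.prod_const, Finset.card_univ, Fintype.card_coe]
      _ ≤ ∏ i, (P.prod P).real (siteCounts (cells x w N) i ⁻¹' B y i) :=
          Finset.prod_le_prod (fun i _ => by positivity) (fun i _ => hfac i)
  -- the TV lemma
  have hTV := abs_real_sub_sitePercolation_half_le (P.prod P) (blockConfig δ (δ ^ 2)) F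
    (crudeCrossing_determinedBy R δ hF) G hGm hGX hq0 hq1 hGge
  -- numerics
  have hpow : 1 - q ^ n ≤ n * (1 - q) := by
    have h := one_add_mul_le_pow (a := q - 1) (by linarith) n
    rw [add_sub_cancel] at h
    linarith
  have h1q : 1 - q ≤ 2 * Real.exp (-2 * Vv) := by
    have : q' ≤ q := le_max_right _ _
    rw [hq'] at this
    linarith
  have hexp : Real.exp (-2 * Vv) = Real.exp (-(Real.pi / 8 * δ⁻¹ ^ 2)) := by
    congr 1; rw [hVv]; ring
  calc |blockCrossingProb P P R δ (δ ^ 2) - siteCrossingProb R δ| ≤ 1 - q ^ n := hTV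
    _ ≤ n * (1 - q) := hpow
    _ ≤ (98 * ρ ^ 2 * δ⁻¹ ^ 2) * (2 * Real.exp (-2 * Vv)) :=
        mul_le_mul hnle h1q (by linarith) (by positivity)
    _ = 196 * ρ ^ 2 * (δ⁻¹ ^ 2 * Real.exp (-(Real.pi / 8 * δ⁻¹ ^ 2))) := by rw [hexp]; ring

/-! ### The stub -/

/-- **K0 — cells of scale `δ²` ARE site percolation** (stub `stub_smallCells` of the line `Sketch`
for the crux `SquareFromVoronoiHub`, card `voronoi-blocks-on-fixed-gs`): for Poisson nuclei of
Lebesgue intensity and every conformal rectangle, the crude `G_s(δ)` crossing probabilities of the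
Voronoi-block colouring at cell scale `δ²` and of fair site percolation differ by `o(1)` as
`δ → 0⁺` — quantitatively by `≤ 196 ρ² δ⁻² e^{-π/(8δ²)}` (`Ω ⊆ B(0,ρ)`), after identifying the two
Poisson laws by Rényi uniqueness.  (Bollobás–Riordan 2006, Ch. 8 §8.3 flavour.) [folklore] -/
theorem stub_smallCells :
  ∀ (PB PW : Measure (PointConfig ℂ)),
    IsPoissonPointProcess (volume : Measure ℂ) PB → IsPoissonPointProcess (volume : Measure ℂ) PW →
    ∀ R : ConformalRectangle,
      Tendsto (fun δ : ℝ => blockCrossingProb PB PW R δ (δ ^ 2) - siteCrossingProb R δ)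
        (𝓝[>] 0) (𝓝 0) := by
  intro PB PW hB hW R
  obtain rfl : PB = PW := IsPoissonPointProcess.unique_holds hB hW
  obtain ⟨ρ₀, hρ₀⟩ := R.isBounded.subset_ball 0
  set ρ := max ρ₀ 1 with hρ
  have hρ1 : 1 ≤ ρ := le_max_right _ _
  have hΩ : R.carrier ⊆ Metric.ball 0 ρ := hρ₀.trans (Metric.ball_subset_ball (le_max_left _ _))
  have hc : (0 : ℝ) < Real.pi / 8 := by positivity
  have hlim : Tendsto (fun δ : ℝ => 196 * ρ ^ 2 * (δ⁻¹ ^ 2 * Real.exp (-(Real.pi / 8 * δ⁻¹ ^ 2))))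
      (𝓝[>] 0) (𝓝 0) := by
    have h1 : Tendsto (fun t : ℝ => t ^ 1 * Real.exp (-t)) atTop (𝓝 0) :=
      Real.tendsto_pow_mul_exp_neg_atTop_nhds_zero 1
    have h2 : Tendsto (fun δ : ℝ => Real.pi / 8 * δ⁻¹ ^ 2) (𝓝[>] 0) atTop :=
      Tendsto.const_mul_atTop hc ((tendsto_pow_atTop two_ne_zero).comp tendsto_inv_nhdsGT_zero)
    have h3 := (h1.comp h2).const_mul (196 * ρ ^ 2 * (Real.pi / 8)⁻¹)
    rw [mul_zero] at h3
    refine h3.congr fun δ => ?_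
    have e : (Real.pi / 8)⁻¹ * (Real.pi / 8 * δ⁻¹ ^ 2) = δ⁻¹ ^ 2 := inv_mul_cancel_left₀ hc.ne' _
    simp only [Function.comp, pow_one]
    rw [show 196 * ρ ^ 2 * (Real.pi / 8)⁻¹ * (Real.pi / 8 * δ⁻¹ ^ 2 *
        Real.exp (-(Real.pi / 8 * δ⁻¹ ^ 2))) = 196 * ρ ^ 2 * (((Real.pi / 8)⁻¹ *
        (Real.pi / 8 * δ⁻¹ ^ 2)) * Real.exp (-(Real.pi / 8 * δ⁻¹ ^ 2))) by ring, e]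
  refine squeeze_zero_norm' ?_ hlim
  filter_upwards [Ioo_mem_nhdsGT (zero_lt_one' ℝ)] with δ hδ
  rw [Real.norm_eq_abs]
  exact abs_blockCrossingProb_sub_siteCrossingProb_le hB R hρ1 hΩ hδ.1 hδ.2.le

end Summit.CriticalPhenomena.CardyFormulaZ2.Cruxes.SquareFromVoronoiHub.VoronoiBlocks.SmallCells

namespace Summit.CriticalPhenomena.CardyFormulaZ2.Cruxes.SquareFromVoronoiHub.VoronoiBlocks

open Literature.Analysis.FunctionSpaces (PointConfig IsPoissonPointProcess)
open Literature.Probability.RandomPlanarGeometry (ConformalRectangle)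

/-- **`stub_smallCells` in the skeleton's namespace** (K0 of the line `Sketch`, crux
`SquareFromVoronoiHub`, stmt-CriticalPhenomena-6434): verbatim the registered signature, over the
objects of `CardyFlipRussoSquareFromVoronoiHubDefs`. [folklore] -/
theorem stub_smallCells :
  ∀ (PB PW : Measure (PointConfig ℂ)),
    IsPoissonPointProcess (volume : Measure ℂ) PB → IsPoissonPointProcess (volume : Measure ℂ) PW →
    ∀ R : ConformalRectangle,
      Tendsto (fun δ : ℝ => blockCrossingProb PB PW R δ (δ ^ 2) - siteCrossingProb R δ)
        (𝓝[>] 0) (𝓝 0) :=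
  SmallCells.stub_smallCells

end Summit.CriticalPhenomena.CardyFormulaZ2.Cruxes.SquareFromVoronoiHub.VoronoiBlocks

end
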